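import Mathlib
import HarnessLib
import Summits.HubbardSuperconductivity.HubbardSuperconductivity.Theorems.KLProgrammeH10TwoPointLimitRelativeSectorCount

/-!
# Route `KLProgramme` — crux K1 `H10TwoPointLimit` (stmt-HubbardSuperconductivity-19938):
# the sector counts for a PERTURBED dispersion (BGM's moving Fermi curve `E_h`) by shell inclusion

Benfatto–Giuliani–Mastropietro 2006 state their counting lemmas (Lemma 3.1 / App. A2, Lemma A3.1) for the sectors of the
scale-`h` dispersion `E_h = ε₀ + (self-energy corrections)` (§2.4 (2.36): `sup |E_h - ε₀| ≤ C|U||h|γ^{2h}`, far inside the shell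
thickness `γ^h e₀`), while the tree's toolbox and the files of this crux count on the FREE band `ε₀ = sqDispersion`. For the
COUNTING statements this is no gap (cell gate-hubbard-kl, GAP-LEDGER G-002 / D-G-002, hubbard-kl-lit AUDIT-A1A2 §0.5): a momentum
with `|E(k) - μ| ≤ η` and `|E(k) - ε₀(k)| ≤ η'` satisfies `|ε₀(k) - μ| ≤ η + η'`, so every count for `E`-shells is dominated by
the free count with an enlarged radial tolerance — which all three counting inputs of Paper 1 quantify over. This file records
the three one-line consequences, for an ARBITRARY function `E` on the square (no regularity needed):

* `cell_of_perturbed_level_of_angle` — the cell geometry (`cell_of_level_of_angle`) for `E`-shells, radius `(η + η')/Dt_min + s_max α`;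
* `lastLeg_count_perturbed_le` — the «one determined leg» count (`lastLeg_count_le`, input (V)) for `E`-shells;
* (the companion `offsetSectorCount_perturbed` — Cor. F.3 with slack for `E`-shells, input (E) — lives with the endpoint sums in
  `…SectorCountBGMEndpoint.lean`, next to `offsetSectorCount_slack`'s other consumer).

The geometry of the moving curve (`C²` envelope, BGM Lemma 2.1) is needed for the sector PROPAGATOR bounds (Lemma 2.2), not here.
Everything is proved; no definitions, no named facts. References: BGM 2006 §2.4 (2.36)–(2.39), Lemma 2.1, §2.8, App. A2–A3
[cite: BenfattoGiulianiMastropietro2006]; HOME/AUDIT-A1A2.md §0.5, §2 row 2.12; HOME/prover-p4/COUNTING-NOTE-2.md §5(b′).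
-/

noncomputable section

namespace Summit.HubbardSuperconductivity.HubbardSuperconductivity.Theorems.RelativeSectorCount

set_option linter.dupNamespace false -- summit = problem name (single-conjunct summit), D-0017

open Classical
open Real Set
open Literature.MathematicalPhysics.QuantumLattice Literature.MathematicalPhysics.QuantumLattice.BandSectorCounting

/-- **Shell inclusion**: `|E(k) - μ| ≤ η` and `|E(k) - ε₀(k)| ≤ η'` give `|ε₀(k) - μ| ≤ η + η'`. [folklore] -/
theorem shell_of_perturbed {E : (Fin 2 → ℝ) → ℝ} {k : Fin 2 → ℝ} {μ η η' : ℝ}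
    (hE : |E k - sqDispersion k| ≤ η') (hk : |E k - μ| ≤ η) : |sqDispersion k - μ| ≤ η + η' := by
  have : sqDispersion k - μ = (E k - μ) - (E k - sqDispersion k) := by ring
  rw [this]
  exact (abs_sub _ _).trans (by linarith)

section Perturbed

variable {a b : ℝ} (B : BandBounds a b) {μ : ℝ} (hμ : μ ∈ Icc a b)
include B hμ

/-- **Cell geometry for a perturbed dispersion** (BGM's `E_h`-sectors, (2.69) with (2.36)): if `sup_square |E - ε₀| ≤ η'`, a
momentum of the closed square with `|E(k) - μ| ≤ η` and polar angle within `α` of `θ₀` (mod `2π`) is within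
`(η + η')/Dt_min + s_max α` of the FREE curve point `p_μ(θ₀)`, coordinatewise. [cite: BenfattoGiulianiMastropietro2006, §2.7 (2.69), §2.4 (2.36)] -/
theorem cell_of_perturbed_level_of_angle {E : (Fin 2 → ℝ) → ℝ} {η' : ℝ}
    (hE : ∀ k : Fin 2 → ℝ, (∀ i, |k i| ≤ π) → |E k - sqDispersion k| ≤ η')
    {k : Fin 2 → ℝ} {η α θ₀ : ℝ} {m : ℤ} (hk : ∀ i, |k i| ≤ π)
    (hshell : |E k - μ| ≤ η) (hlo : a ≤ μ - (η + η')) (hhi : μ + (η + η') ≤ b)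
    (hang : |Complex.arg (⟨k 0, k 1⟩ : ℂ) + m * (2 * π) - θ₀| ≤ α) :
    |k 0 - bandX μ θ₀| ≤ (η + η') / B.Dtmin + B.smax * α ∧ |k 1 - bandY μ θ₀| ≤ (η + η') / B.Dtmin + B.smax * α :=
  cell_of_level_of_angle B hμ hk (shell_of_perturbed (hE k hk) hshell) hlo hhi hang

/-- **The last leg is determined, for `E`-shells** (input (V) of Paper 1's Theorem 2.1 on the moving curve): the count of
`lastLeg_count_le` with the radial condition `|E(k) - μ| ≤ η`, `sup_square |E - ε₀| ≤ η'`, is bounded by the free count with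
tolerance `η + η'`: `≤ 3 (2π √2 (ρ + (η + η')/Dt_min + s_max α)/(u_min w) + 1)`, uniformly in the target.
[cite: BenfattoGiulianiMastropietro2006, §2.8 (2.89), App. A3] -/
theorem lastLeg_count_perturbed_le {E : (Fin 2 → ℝ) → ℝ} {η' : ℝ}
    (hE : ∀ k : Fin 2 → ℝ, (∀ i, |k i| ≤ π) → |E k - sqDispersion k| ≤ η')
    {N : ℕ} {w : ℝ} (hw : 0 < w) (hN : (N : ℝ) * w = 2 * π)
    {η α ρ : ℝ} (hη : 0 ≤ η + η') (hα : 0 ≤ α) (hρ : 0 ≤ ρ) (hlo : a ≤ μ - (η + η')) (hhi : μ + (η + η') ≤ b)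
    (qx qy : ℝ) :
    ((((Finset.range N).filter fun ω : ℕ => ∃ k : Fin 2 → ℝ, (∀ i, |k i| ≤ π) ∧ |E k - μ| ≤ η ∧
        (∃ m : ℤ, |Complex.arg (⟨k 0, k 1⟩ : ℂ) + m * (2 * π) - (w / 2 + ω * w)| ≤ α) ∧
        |k 0 - qx| ≤ ρ ∧ |k 1 - qy| ≤ ρ).card : ℝ)) ≤
      3 * (2 * (π * (Real.sqrt 2 * (ρ + ((η + η') / B.Dtmin + B.smax * α)) / B.umin)) / w + 1) := by
  refine le_trans ?_ (lastLeg_count_le B hμ hw hN hη hα hρ hlo hhi qx qy)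
  exact_mod_cast Finset.card_le_card (Finset.monotone_filter_right _ fun ω _ hω => by
    obtain ⟨k, hk, hshell, hang, hx, hy⟩ := hω
    exact ⟨k, hk, shell_of_perturbed (hE k hk) hshell, hang, hx, hy⟩)

end Perturbed

end Summit.HubbardSuperconductivity.HubbardSuperconductivity.Theorems.RelativeSectorCount
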